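import Summits.QuantumFields.YangMills.Theorems.BalabanUVNodesN15KingModelHeatKernelGradientFullPropagator
import HarnessLib

/-!
# BalabanUVNodes ∕ N15 — THE KING-MODEL RUNG (PART ∇-m): THE DECAY OF THE FULL PROPAGATOR's BLOCK CORRECTION UNDER THE LATTICE GRADIENT —
# `L²·|∇_u(A₀⁻¹ − G)(u,v)| ≤ C_B(a,m²)∕(1 + tdistT(u,v))³ + C′(a,m²)∕(L·(1 + tdistT(u,v)²))` for ALL `u, v`, every `L ≥ 1`, every `M₀ ≥ 1` — in physical units the correction's gradient is `O(r⁻³) + O(r⁻²)`,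
# bounded AND decaying, η-uniformly (PART Ϻ-c's three-leg books with the DIFFERENCED block row-sums, whose total mass is PART ∇-k's `O(η∕m)`)
# (Track A, DAG node N15 = NE2; FAN-OUT v1.1 §N15 s3 «KING-MODEL RUNG … + what the curved case adds»; count-neutral)

HONEST FRAMING.  Count-neutral (cell `pub-ymgap`, seat `pub-ymgap-dag-n15-e` g57; `--supports stmt-QuantumFields-27247 --as helper` = K3ᴬ).  King's `A = 0` one-step comparison model on
`(ℤ∕LM₀)⁴ → (ℤ∕M₀)⁴`, `c = L²`; NOT Bałaban's `G_k(U)`; crude constants.  PART ∇-l bounded the lattice gradient of the block correction `A₀⁻¹ − G = −L⁻⁴GQᵀΔ_effQG` UNIFORMLY by `O(η⁵)`;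
this file adds its DECAY, by the three-leg split of PART Ϻ-c with `S_u(b)` replaced by the signed `∇S_u(b) = S_{u+e}(b) − S_u(b)`: (A) `dist(b,b′) ≥ D∕3`: `|Δ_eff| ≤ C_Δe^{−κ_AD∕3}` times the
two totals `Σ_b|∇S_u(b)| ≤ Φ_L = 92016000∕(L√m²)` (∇-k∕∇-l) and `ΣS^v = 1∕m²`; (B) `dist(β_u,b) ≥ D∕3`: the CUBE law of PART ∇-f on the `L⁴` sites of `B(b)` (`|∇S_u(b)| ≤ L⁴·343·C_∇∕(L²(1+dist)³)`,
★ `one_div_leg_cube_le_far`) times `Σ|Δ_eff|S^v ≤ C_ΔS_κ∕m²`; (C) `dist(b′,β_v) ≥ D∕3`: Ϻ-c's `S^v(b′) ≤ L⁴·49C₀∕(L²(1+dist²))` times `Φ_L·C_ΔS_κ` — this leg sees only the inverse SQUARE of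
`S^v`, and is why the far bound is `cube + η·square` and not a cube: HONEST — an inverse cube for `∇A₀⁻¹` beyond the correlation length needs the mass decay of `G` (door t3⁶²).  Near zone
(`D < 6`): ∇-l's uniform bound through Ϻ-b's `1∕L² ≤ 50∕(1+dist²)`.
CONTENTS.  §1 ★ `one_div_leg_cube_le_far`, ★★ `abs_blockSum_grad_le_far` (leg B with the cube); §2 ★★ `grad_summand_le_three_terms`, ★★★ `abs_grad_doubleSum_le_far`; §3 ★★★ `mul_abs_fullProp_grad_correction_le_far`,
★★★ `mul_abs_fullProp_grad_correction_le_near`, ★★★★ **`king_fullProp_grad_correction_decay`** (all `u, v`: `L²|∇_u(A₀⁻¹−G)(u,v)| ≤ C_B∕(1+dist)³ + C′∕(L(1+dist²))`), ★★★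
`king_fullProp_grad_correction_decay_physical` (`tdistT ≥ L·d`, `d > 0` ⟹ `L⁵|∇_u(A₀⁻¹−G)| ≤ C_B∕d³ + C′∕d²`).
PRIOR TREE ART (by name): Ϻ-a `blockSum_lapF_inv_col_nonneg` ∕ `sum_blockSum_lapF_inv_col`, Ϻ-b `exists_leg_ge_third` ∕ `mul_tdistT_blockOf_le` ∕ `sum_abs_effLaplacian_le`∕`'` ∕ `inv_sq_le_near` ∕ `exp_tail_le_far`, Ϻ-c
`blockSum_lapF_inv_col_le_far` ∕ `abs_effLaplacian_le_far` ∕ `card_offsets_four`, R-a `Curved.tdistT_fine_le_blocks`, ∇-f `king_green_grad_powerLaw_tdistT`, ∇-l `fineOp_inv_grad_eq` ∕ `sum_abs_blockSum_grad_le` ∕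
`king_fullProp_grad_correction_le` ∕ `abs_blockSum_sub_le`.
Dedup (rg at filing): basename 0 files; needles `king_fullProp_grad_correction_decay|abs_blockSum_grad_le_far|grad_summand_le_three_terms|abs_grad_doubleSum_le_far|one_div_leg_cube_le_far` 0 tree files.
Locators: [King1986] (2.13)–(2.15) p.653, (3.63) p.663, (4.33)–(4.34) p.674, (4.44)–(4.45) p.675; [Balaban1983RegularityDecay] §5 p.600; [Dimock2013] App. D Lemma 30.  0 `sorry`, 0 `def`.
-/

noncomputable section

open Real Finset Matrix
open scoped BigOperators

namespace Summit.QuantumFields.YangMills.BalabanUVNodes.N15KingModelRung.HeatKernel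

open Literature.MathematicalPhysics.QuantumFieldTheory.Balaban1983to89.B5Prop11Plancherel (Tor fine unitVec)
open Literature.MathematicalPhysics.QuantumFieldTheory.Balaban1983to89.Beta.WoodburyFibre (cM)
open Literature.MathematicalPhysics.QuantumFieldTheory.Balaban1983to89 (B4Sect5Proof.latticeConst)
open Literature.MathematicalPhysics.QuantumFieldTheory.King1986.Torus
  (lapF fineOp effLaplacian blockSum site blockOf tdistT tdistT_nonneg tdistT_symm CDelta kapA kapA_pos CDelta_pos)
open Summit.QuantumFields.YangMills.BalabanUVNodes.N15KingModelRung.Curved (tdistT_fine_le_blocks)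

variable (L M₀ : ℕ) [NeZero L] [NeZero M₀] {a m2 : ℝ}

/-! ## §1 Leg (B) with the cube -/

omit [NeZero L] [NeZero M₀] in
/-- ★ FAR LEG, CUBE VERSION: if `D ≥ 6`, `ℓ ≥ D∕3`, `s ≥ N·ℓ − (N−1)`, `0 ≤ t ≤ N·D + (N−1)` and `N ≥ 1`, then `1∕(1+s)³ ≤ 343∕(1+t)³` (`1+t ≤ 7(1+s)`). [folklore] -/
theorem one_div_leg_cube_le_far {Nr D ℓ s t : ℝ} (hN : 1 ≤ Nr) (hD : 6 ≤ D) (hℓ : D / 3 ≤ ℓ) (hs : Nr * ℓ - (Nr - 1) ≤ s) (ht0 : 0 ≤ t) (ht : t ≤ Nr * D + (Nr - 1)) :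
    1 / (1 + s) ^ 3 ≤ 343 / (1 + t) ^ 3 := by
  have hND : 6 ≤ Nr * D := by nlinarith
  have h1 : Nr * D / 6 ≤ s := by nlinarith
  have h2 : t ≤ 7 * (Nr * D) / 6 := by nlinarith
  have hs0 : 0 < 1 + s := by nlinarith
  have h3 : 1 + t ≤ 7 * (1 + s) := by nlinarith
  have h4 : (1 + t) ^ 3 ≤ (7 * (1 + s)) ^ 3 := pow_le_pow_left₀ (by linarith) h3 3
  rw [div_le_div_iff₀ (by positivity) (by positivity)]
  nlinarith [pow_pos hs0 3]

/-- ★★ **LEG (B) FOR THE DIFFERENCED ROW-SUM**: if the blocks `β_u ∋ u`, `β_v ∋ v` are `D ≥ 6` apart and `dist_M(β_u,b) ≥ D∕3`, then `|S_{u+e_ν}(b) − S_u(b)| ≤ L⁴·(343·4940000∕L²)∕(1+dist(u,v))³`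
(PART ∇-f's cube law on each of the `L⁴` sites of `B(b)`, all at fine distance `≥ LD∕6` from `u`). [cite: King1986, (2.13) p.653, (3.63) p.663, (4.4) p.670] -/
theorem abs_blockSum_grad_le_far (hm : 0 < m2) (u v : Tor (fine L (cM M₀))) (ν : Fin 4) (b : Tor (cM M₀))
    (hD : 6 ≤ tdistT (cM M₀) (blockOf L (cM M₀) u) (blockOf L (cM M₀) v))
    (hleg : tdistT (cM M₀) (blockOf L (cM M₀) u) (blockOf L (cM M₀) v) / 3 ≤ tdistT (cM M₀) (blockOf L (cM M₀) u) b) :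
    |blockSum L (cM M₀) (fun x => (lapF (fine L (cM M₀)) ((L : ℝ) ^ 2) m2)⁻¹ (u + unitVec (fine L (cM M₀)) ν) x) b
        - blockSum L (cM M₀) (fun x => (lapF (fine L (cM M₀)) ((L : ℝ) ^ 2) m2)⁻¹ u x) b|
      ≤ (L : ℝ) ^ 4 * ((343 * 4940000 / (L : ℝ) ^ 2) / (1 + tdistT (fine L (cM M₀)) u v) ^ 3) := by
  have hL1 : (1 : ℝ) ≤ L := by exact_mod_cast Nat.one_le_iff_ne_zero.mpr (NeZero.ne L)
  have hL2 : (0 : ℝ) < (L : ℝ) ^ 2 := by positivity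
  have ht0 := tdistT_nonneg (fine L (cM M₀)) u v
  have ht := tdistT_fine_le_blocks L (cM M₀) u v
  refine (abs_blockSum_sub_le L M₀ _ _ b).trans ?_
  have hterm : ∀ j : Fin 4 → Fin L, |(lapF (fine L (cM M₀)) ((L : ℝ) ^ 2) m2)⁻¹ (u + unitVec (fine L (cM M₀)) ν) (site L (cM M₀) b j) - (lapF (fine L (cM M₀)) ((L : ℝ) ^ 2) m2)⁻¹ u (site L (cM M₀) b j)|
      ≤ (343 * 4940000 / (L : ℝ) ^ 2) / (1 + tdistT (fine L (cM M₀)) u v) ^ 3 := by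
    intro j
    have hs := mul_tdistT_blockOf_le L (cM M₀) u b j
    have hpl := king_green_grad_powerLaw_tdistT L M₀ hm u (site L (cM M₀) b j) ν
    have hs0 : 0 ≤ tdistT (fine L (cM M₀)) u (site L (cM M₀) b j) := tdistT_nonneg _ _ _
    have hleg' := one_div_leg_cube_le_far (s := tdistT (fine L (cM M₀)) u (site L (cM M₀) b j)) hL1 hD hleg (by linarith) ht0 ht
    calc |(lapF (fine L (cM M₀)) ((L : ℝ) ^ 2) m2)⁻¹ (u + unitVec (fine L (cM M₀)) ν) (site L (cM M₀) b j) - (lapF (fine L (cM M₀)) ((L : ℝ) ^ 2) m2)⁻¹ u (site L (cM M₀) b j)|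
        ≤ (4940000 / (1 + tdistT (fine L (cM M₀)) u (site L (cM M₀) b j)) ^ 3) / (L : ℝ) ^ 2 := by rw [le_div_iff₀ hL2, mul_comm]; exact hpl
      _ = (4940000 / (L : ℝ) ^ 2) * (1 / (1 + tdistT (fine L (cM M₀)) u (site L (cM M₀) b j)) ^ 3) := by ring
      _ ≤ (4940000 / (L : ℝ) ^ 2) * (343 / (1 + tdistT (fine L (cM M₀)) u v) ^ 3) := mul_le_mul_of_nonneg_left hleg' (by positivity)
      _ = (343 * 4940000 / (L : ℝ) ^ 2) / (1 + tdistT (fine L (cM M₀)) u v) ^ 3 := by ring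
  unfold blockSum
  calc ∑ j : Fin 4 → Fin L, |(lapF (fine L (cM M₀)) ((L : ℝ) ^ 2) m2)⁻¹ (u + unitVec (fine L (cM M₀)) ν) (site L (cM M₀) b j) - (lapF (fine L (cM M₀)) ((L : ℝ) ^ 2) m2)⁻¹ u (site L (cM M₀) b j)|
      ≤ ∑ _j : Fin 4 → Fin L, (343 * 4940000 / (L : ℝ) ^ 2) / (1 + tdistT (fine L (cM M₀)) u v) ^ 3 := Finset.sum_le_sum fun j _ => hterm j
    _ = (L : ℝ) ^ 4 * ((343 * 4940000 / (L : ℝ) ^ 2) / (1 + tdistT (fine L (cM M₀)) u v) ^ 3) := by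
        rw [Finset.sum_const, Finset.card_univ, nsmul_eq_mul, card_offsets_four]

/-! ## §2 The three-term domination for the differenced sandwich and its sum -/

/-- ★★ **THE POINTWISE THREE-TERM DOMINATION** (`D = dist_M(β_u,β_v) ≥ 6`): for every pair of blocks `(b,b′)`,
`|∇S_u(b)|·|Δ_eff(b,b′)|·S^v(b′) ≤ |∇S_u(b)|·C_Δe^{−κ_AD∕3}·S^v(b′) + β_B·|Δ_eff|·S^v(b′) + |∇S_u(b)|·|Δ_eff|·β_C` with `β_B = L⁴(343C_∇∕L²)∕(1+dist)³`, `β_C = L⁴(49C₀∕L²)∕(1+dist²)`.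
[cite: King1986, (4.34) p.674, (4.44)–(4.45) p.675] -/
theorem grad_summand_le_three_terms (ha : 0 < a) (hm : 0 < m2) (u v : Tor (fine L (cM M₀))) (ν : Fin 4) (hD : 6 ≤ tdistT (cM M₀) (blockOf L (cM M₀) u) (blockOf L (cM M₀) v))
    (b b' : Tor (cM M₀)) :
    |blockSum L (cM M₀) (fun x => (lapF (fine L (cM M₀)) ((L : ℝ) ^ 2) m2)⁻¹ (u + unitVec (fine L (cM M₀)) ν) x) b
        - blockSum L (cM M₀) (fun x => (lapF (fine L (cM M₀)) ((L : ℝ) ^ 2) m2)⁻¹ u x) b|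
        * |effLaplacian L (cM M₀) a ((L : ℝ) ^ 2) m2 b b'| * blockSum L (cM M₀) (fun x => (lapF (fine L (cM M₀)) ((L : ℝ) ^ 2) m2)⁻¹ x v) b'
      ≤ |blockSum L (cM M₀) (fun x => (lapF (fine L (cM M₀)) ((L : ℝ) ^ 2) m2)⁻¹ (u + unitVec (fine L (cM M₀)) ν) x) b
            - blockSum L (cM M₀) (fun x => (lapF (fine L (cM M₀)) ((L : ℝ) ^ 2) m2)⁻¹ u x) b|
            * (CDelta a 4 * Real.exp (-(kapA a 4 * (tdistT (cM M₀) (blockOf L (cM M₀) u) (blockOf L (cM M₀) v) / 3))))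
            * blockSum L (cM M₀) (fun x => (lapF (fine L (cM M₀)) ((L : ℝ) ^ 2) m2)⁻¹ x v) b'
        + ((L : ℝ) ^ 4 * ((343 * 4940000 / (L : ℝ) ^ 2) / (1 + tdistT (fine L (cM M₀)) u v) ^ 3)) * |effLaplacian L (cM M₀) a ((L : ℝ) ^ 2) m2 b b'|
            * blockSum L (cM M₀) (fun x => (lapF (fine L (cM M₀)) ((L : ℝ) ^ 2) m2)⁻¹ x v) b'
        + |blockSum L (cM M₀) (fun x => (lapF (fine L (cM M₀)) ((L : ℝ) ^ 2) m2)⁻¹ (u + unitVec (fine L (cM M₀)) ν) x) b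
            - blockSum L (cM M₀) (fun x => (lapF (fine L (cM M₀)) ((L : ℝ) ^ 2) m2)⁻¹ u x) b|
            * |effLaplacian L (cM M₀) a ((L : ℝ) ^ 2) m2 b b'| * ((L : ℝ) ^ 4 * ((49 * (34016 + 10 / m2) / (L : ℝ) ^ 2) / (1 + tdistT (fine L (cM M₀)) u v ^ 2))) := by
  have hc : (0 : ℝ) ≤ (L : ℝ) ^ 2 := by positivity
  set Dg := |blockSum L (cM M₀) (fun x => (lapF (fine L (cM M₀)) ((L : ℝ) ^ 2) m2)⁻¹ (u + unitVec (fine L (cM M₀)) ν) x) b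
        - blockSum L (cM M₀) (fun x => (lapF (fine L (cM M₀)) ((L : ℝ) ^ 2) m2)⁻¹ u x) b| with hDg
  set S' := blockSum L (cM M₀) (fun x => (lapF (fine L (cM M₀)) ((L : ℝ) ^ 2) m2)⁻¹ x v) b' with hS'
  set Δ := |effLaplacian L (cM M₀) a ((L : ℝ) ^ 2) m2 b b'| with hΔ
  set K := CDelta a 4 * Real.exp (-(kapA a 4 * (tdistT (cM M₀) (blockOf L (cM M₀) u) (blockOf L (cM M₀) v) / 3))) with hK
  set βB := (L : ℝ) ^ 4 * ((343 * 4940000 / (L : ℝ) ^ 2) / (1 + tdistT (fine L (cM M₀)) u v) ^ 3) with hβB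
  set βC := (L : ℝ) ^ 4 * ((49 * (34016 + 10 / m2) / (L : ℝ) ^ 2) / (1 + tdistT (fine L (cM M₀)) u v ^ 2)) with hβC
  have ht0 := tdistT_nonneg (fine L (cM M₀)) u v
  have hDg0 : 0 ≤ Dg := abs_nonneg _
  have hS'0 : 0 ≤ S' := blockSum_lapF_inv_col_nonneg L (cM M₀) hc hm v b'
  have hΔ0 : 0 ≤ Δ := abs_nonneg _
  have hK0 : 0 ≤ K := mul_nonneg (CDelta_pos ha 4).le (Real.exp_pos _).le
  have hβB0 : 0 ≤ βB := by positivity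
  have hβC0 : 0 ≤ βC := by positivity
  have hTA : 0 ≤ Dg * K * S' := by positivity
  have hTB : 0 ≤ βB * Δ * S' := by positivity
  have hTC : 0 ≤ Dg * Δ * βC := by positivity
  rcases exists_leg_ge_third (cM M₀) (blockOf L (cM M₀) u) (blockOf L (cM M₀) v) b b' with hA | hB | hC
  · -- leg (B): `dist(β_u, b) ≥ D∕3`
    have h1 : Dg ≤ βB := abs_blockSum_grad_le_far L M₀ hm u v ν b hD hA
    have : Dg * Δ * S' ≤ βB * Δ * S' := mul_le_mul_of_nonneg_right (mul_le_mul_of_nonneg_right h1 hΔ0) hS'0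
    linarith
  · -- leg (A): `dist(b, b′) ≥ D∕3`
    have h1 : Δ ≤ K := abs_effLaplacian_le_far L M₀ ha hm b b' hB
    have : Dg * Δ * S' ≤ Dg * K * S' := mul_le_mul_of_nonneg_right (mul_le_mul_of_nonneg_left h1 hDg0) hS'0
    linarith
  · -- leg (C): `dist(b′, β_v) ≥ D∕3`
    have h1 : S' ≤ βC := blockSum_lapF_inv_col_le_far L M₀ hm u v b' hD hC
    have : Dg * Δ * S' ≤ Dg * Δ * βC := mul_le_mul_of_nonneg_left h1 (mul_nonneg hDg0 hΔ0)
    linarith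

/-- ★★★ **THE FAR DOUBLE SUM FOR THE DIFFERENCED SANDWICH**: for `D = dist_M(β_u,β_v) ≥ 6`, with `Φ_L = 92016000∕(L√m²)` (∇-l), `S_κ = latticeConst 4 κ_A`:
`Σ_{b,b′}|∇S_u(b)|·|Δ_eff(b,b′)|·S^v(b′) ≤ C_Δe^{−κ_AD∕3}·Φ_L∕m² + β_B·C_ΔS_κ∕m² + Φ_L·C_ΔS_κ·β_C`. [cite: King1986, (4.34) p.674, (4.44)–(4.45) p.675; Balaban1983RegularityDecay, §5 p.600] -/
theorem abs_grad_doubleSum_le_far (ha : 0 < a) (hm : 0 < m2) (u v : Tor (fine L (cM M₀))) (ν : Fin 4) (hD : 6 ≤ tdistT (cM M₀) (blockOf L (cM M₀) u) (blockOf L (cM M₀) v)) :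
    ∑ b, ∑ b', |blockSum L (cM M₀) (fun x => (lapF (fine L (cM M₀)) ((L : ℝ) ^ 2) m2)⁻¹ (u + unitVec (fine L (cM M₀)) ν) x) b
          - blockSum L (cM M₀) (fun x => (lapF (fine L (cM M₀)) ((L : ℝ) ^ 2) m2)⁻¹ u x) b|
        * |effLaplacian L (cM M₀) a ((L : ℝ) ^ 2) m2 b b'| * blockSum L (cM M₀) (fun x => (lapF (fine L (cM M₀)) ((L : ℝ) ^ 2) m2)⁻¹ x v) b'
      ≤ CDelta a 4 * Real.exp (-(kapA a 4 * (tdistT (cM M₀) (blockOf L (cM M₀) u) (blockOf L (cM M₀) v) / 3))) * (92016000 / ((L : ℝ) * Real.sqrt m2)) / m2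
        + ((L : ℝ) ^ 4 * ((343 * 4940000 / (L : ℝ) ^ 2) / (1 + tdistT (fine L (cM M₀)) u v) ^ 3)) * (CDelta a 4 * B4Sect5Proof.latticeConst 4 (kapA a 4)) / m2
        + (92016000 / ((L : ℝ) * Real.sqrt m2)) * (CDelta a 4 * B4Sect5Proof.latticeConst 4 (kapA a 4))
            * ((L : ℝ) ^ 4 * ((49 * (34016 + 10 / m2) / (L : ℝ) ^ 2) / (1 + tdistT (fine L (cM M₀)) u v ^ 2))) := by
  have hc : (0 : ℝ) ≤ (L : ℝ) ^ 2 := by positivity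
  set Dg := fun b => |blockSum L (cM M₀) (fun x => (lapF (fine L (cM M₀)) ((L : ℝ) ^ 2) m2)⁻¹ (u + unitVec (fine L (cM M₀)) ν) x) b
        - blockSum L (cM M₀) (fun x => (lapF (fine L (cM M₀)) ((L : ℝ) ^ 2) m2)⁻¹ u x) b| with hDg
  set S' := fun b' => blockSum L (cM M₀) (fun x => (lapF (fine L (cM M₀)) ((L : ℝ) ^ 2) m2)⁻¹ x v) b' with hS'
  set Δ := fun b b' => |effLaplacian L (cM M₀) a ((L : ℝ) ^ 2) m2 b b'| with hΔ
  set K := CDelta a 4 * Real.exp (-(kapA a 4 * (tdistT (cM M₀) (blockOf L (cM M₀) u) (blockOf L (cM M₀) v) / 3))) with hK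
  set βB := (L : ℝ) ^ 4 * ((343 * 4940000 / (L : ℝ) ^ 2) / (1 + tdistT (fine L (cM M₀)) u v) ^ 3) with hβB
  set βC := (L : ℝ) ^ 4 * ((49 * (34016 + 10 / m2) / (L : ℝ) ^ 2) / (1 + tdistT (fine L (cM M₀)) u v ^ 2)) with hβC
  set CS := CDelta a 4 * B4Sect5Proof.latticeConst 4 (kapA a 4) with hCS
  set Φ : ℝ := 92016000 / ((L : ℝ) * Real.sqrt m2) with hΦ
  have ht0 := tdistT_nonneg (fine L (cM M₀)) u v
  have hsumD : ∑ b, Dg b ≤ Φ := sum_abs_blockSum_grad_le L M₀ hm u ν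
  have hsumS' : ∑ b', S' b' = m2⁻¹ := sum_blockSum_lapF_inv_col L (cM M₀) hc hm v
  have hD0 : ∀ b, 0 ≤ Dg b := fun b => abs_nonneg _
  have hS'0 : ∀ b', 0 ≤ S' b' := fun b' => blockSum_lapF_inv_col_nonneg L (cM M₀) hc hm v b'
  have hK0 : 0 ≤ K := mul_nonneg (CDelta_pos ha 4).le (Real.exp_pos _).le
  have hβB0 : 0 ≤ βB := by positivity
  have hβC0 : 0 ≤ βC := by positivity
  have hrow : ∀ b', ∑ b, Δ b b' ≤ CS := fun b' => sum_abs_effLaplacian_le L (cM M₀) ha hm b'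
  have hcol : ∀ b, ∑ b', Δ b b' ≤ CS := fun b => sum_abs_effLaplacian_le' L (cM M₀) ha hm b
  have hCS0 : 0 ≤ CS := le_trans (Finset.sum_nonneg fun _ _ => abs_nonneg _) (hrow (Classical.arbitrary _))
  have h1 : ∑ b, ∑ b', Dg b * Δ b b' * S' b' ≤ ∑ b, ∑ b', (Dg b * K * S' b' + βB * Δ b b' * S' b' + Dg b * Δ b b' * βC) :=
    Finset.sum_le_sum fun b _ => Finset.sum_le_sum fun b' _ => grad_summand_le_three_terms L M₀ ha hm u v ν hD b b'
  have hA : ∑ b, ∑ b', Dg b * K * S' b' ≤ K * Φ / m2 := by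
    have e : ∑ b, ∑ b', Dg b * K * S' b' = K * (∑ b, Dg b) * (∑ b', S' b') := by
      rw [mul_assoc, Finset.sum_mul_sum, Finset.mul_sum]
      refine Finset.sum_congr rfl fun b _ => ?_
      rw [Finset.mul_sum]
      exact Finset.sum_congr rfl fun b' _ => by ring
    rw [e, hsumS']
    have : K * (∑ b, Dg b) ≤ K * Φ := mul_le_mul_of_nonneg_left hsumD hK0
    rw [div_eq_mul_inv]
    exact mul_le_mul_of_nonneg_right this (by positivity)
  have hB : ∑ b, ∑ b', βB * Δ b b' * S' b' ≤ βB * CS / m2 := by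
    calc ∑ b, ∑ b', βB * Δ b b' * S' b' = βB * ∑ b', S' b' * (∑ b, Δ b b') := by
          rw [Finset.sum_comm, Finset.mul_sum]
          refine Finset.sum_congr rfl fun b' _ => ?_
          rw [Finset.mul_sum, Finset.mul_sum]
          exact Finset.sum_congr rfl fun b _ => by ring
      _ ≤ βB * ∑ b', S' b' * CS := by
          refine mul_le_mul_of_nonneg_left (Finset.sum_le_sum fun b' _ => mul_le_mul_of_nonneg_left (hrow b') (hS'0 b')) hβB0
      _ = βB * CS / m2 := by rw [← Finset.sum_mul, hsumS']; field_simp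
  have hC : ∑ b, ∑ b', Dg b * Δ b b' * βC ≤ Φ * CS * βC := by
    calc ∑ b, ∑ b', Dg b * Δ b b' * βC = βC * ∑ b, Dg b * (∑ b', Δ b b') := by
          rw [Finset.mul_sum]
          refine Finset.sum_congr rfl fun b _ => ?_
          rw [Finset.mul_sum, Finset.mul_sum]
          exact Finset.sum_congr rfl fun b' _ => by ring
      _ ≤ βC * ∑ b, Dg b * CS := by
          refine mul_le_mul_of_nonneg_left (Finset.sum_le_sum fun b _ => mul_le_mul_of_nonneg_left (hcol b) (hD0 b)) hβC0
      _ = βC * ((∑ b, Dg b) * CS) := by rw [← Finset.sum_mul]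
      _ ≤ βC * (Φ * CS) := mul_le_mul_of_nonneg_left (mul_le_mul_of_nonneg_right hsumD hCS0) hβC0
      _ = Φ * CS * βC := by ring
  have hsplit : ∑ b, ∑ b', (Dg b * K * S' b' + βB * Δ b b' * S' b' + Dg b * Δ b b' * βC)
      = (∑ b, ∑ b', Dg b * K * S' b') + (∑ b, ∑ b', βB * Δ b b' * S' b') + (∑ b, ∑ b', Dg b * Δ b b' * βC) := by
    rw [← Finset.sum_add_distrib, ← Finset.sum_add_distrib]
    refine Finset.sum_congr rfl fun b _ => ?_
    rw [← Finset.sum_add_distrib, ← Finset.sum_add_distrib]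
  calc ∑ b, ∑ b', Dg b * Δ b b' * S' b' ≤ _ := h1
    _ = _ := hsplit
    _ ≤ K * Φ / m2 + βB * CS / m2 + Φ * CS * βC := add_le_add (add_le_add hA hB) hC

/-! ## §3 The decay of the block correction's gradient -/

/-- ★★★ **THE FAR ZONE** (`dist_M(β_u,β_v) ≥ 6`): `L²·|∇_u(A₀⁻¹−G)(u,v)| ≤ (343·4940000·C_ΔS_κ∕m²)∕(1+dist)³ + (92016000·(50C_Δ∕κ_A² + 49C₀·C_ΔS_κ·m²)∕(m²√m²))∕(L(1+dist²))`.
[cite: King1986, (2.13)–(2.15) p.653, (3.63) p.663, (4.34) p.674, (4.44)–(4.45) p.675] -/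
theorem mul_abs_fullProp_grad_correction_le_far (ha : 0 < a) (hm : 0 < m2) (u v : Tor (fine L (cM M₀))) (ν : Fin 4)
    (hD : 6 ≤ tdistT (cM M₀) (blockOf L (cM M₀) u) (blockOf L (cM M₀) v)) :
    (L : ℝ) ^ 2 * |((fineOp L (cM M₀) a ((L : ℝ) ^ 2) m2)⁻¹ (u + unitVec (fine L (cM M₀)) ν) v - (fineOp L (cM M₀) a ((L : ℝ) ^ 2) m2)⁻¹ u v)
        - ((lapF (fine L (cM M₀)) ((L : ℝ) ^ 2) m2)⁻¹ (u + unitVec (fine L (cM M₀)) ν) v - (lapF (fine L (cM M₀)) ((L : ℝ) ^ 2) m2)⁻¹ u v)|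
      ≤ (343 * 4940000 * (CDelta a 4 * B4Sect5Proof.latticeConst 4 (kapA a 4)) / m2) / (1 + tdistT (fine L (cM M₀)) u v) ^ 3
        + (92016000 * (50 * CDelta a 4 / kapA a 4 ^ 2 + 49 * (34016 + 10 / m2) * (CDelta a 4 * B4Sect5Proof.latticeConst 4 (kapA a 4)) * m2) / (m2 * Real.sqrt m2))
            / ((L : ℝ) * (1 + tdistT (fine L (cM M₀)) u v ^ 2)) := by
  have hL1 : (1 : ℝ) ≤ L := by exact_mod_cast Nat.one_le_iff_ne_zero.mpr (NeZero.ne L)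
  have hL0 : (0 : ℝ) < L := by positivity
  have hc : (0 : ℝ) ≤ (L : ℝ) ^ 2 := by positivity
  have hsm : 0 < Real.sqrt m2 := Real.sqrt_pos.mpr hm
  have ht0 := tdistT_nonneg (fine L (cM M₀)) u v
  have ht := tdistT_fine_le_blocks L (cM M₀) u v
  set t := tdistT (fine L (cM M₀)) u v with htdef
  set D := tdistT (cM M₀) (blockOf L (cM M₀) u) (blockOf L (cM M₀) v) with hDdef
  set C0 : ℝ := 34016 + 10 / m2 with hC0
  set CS := CDelta a 4 * B4Sect5Proof.latticeConst 4 (kapA a 4) with hCS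
  set Φ : ℝ := 92016000 / ((L : ℝ) * Real.sqrt m2) with hΦ
  have hC00 : 0 ≤ C0 := by positivity
  have hCD := (CDelta_pos ha 4).le
  have hCS0 : 0 ≤ CS := le_trans (Finset.sum_nonneg fun _ _ => abs_nonneg _) (sum_abs_effLaplacian_le L (cM M₀) ha hm (blockOf L (cM M₀) u))
  have hsum := abs_grad_doubleSum_le_far L M₀ ha hm u v ν hD
  have hL4 : ((L : ℝ) ^ (3 + 1))⁻¹ = ((L : ℝ) ^ 4)⁻¹ := by norm_num
  have habs : |((fineOp L (cM M₀) a ((L : ℝ) ^ 2) m2)⁻¹ (u + unitVec (fine L (cM M₀)) ν) v - (fineOp L (cM M₀) a ((L : ℝ) ^ 2) m2)⁻¹ u v)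
        - ((lapF (fine L (cM M₀)) ((L : ℝ) ^ 2) m2)⁻¹ (u + unitVec (fine L (cM M₀)) ν) v - (lapF (fine L (cM M₀)) ((L : ℝ) ^ 2) m2)⁻¹ u v)|
      ≤ ((L : ℝ) ^ 4)⁻¹ * (CDelta a 4 * Real.exp (-(kapA a 4 * (D / 3))) * Φ / m2 + ((L : ℝ) ^ 4 * ((343 * 4940000 / (L : ℝ) ^ 2) / (1 + t) ^ 3)) * CS / m2
          + Φ * CS * ((L : ℝ) ^ 4 * ((49 * C0 / (L : ℝ) ^ 2) / (1 + t ^ 2)))) := by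
    rw [fineOp_inv_grad_eq L M₀ ha hm u v ν, sub_sub_cancel_left, abs_neg, abs_mul, hL4, abs_of_pos (by positivity : (0 : ℝ) < ((L : ℝ) ^ 4)⁻¹)]
    refine mul_le_mul_of_nonneg_left ?_ (by positivity)
    refine le_trans ((Finset.abs_sum_le_sum_abs _ _).trans (Finset.sum_le_sum fun b _ => (Finset.abs_sum_le_sum_abs _ _).trans
      (Finset.sum_le_sum fun b' _ => le_of_eq ?_))) hsum
    rw [abs_mul, abs_mul, abs_of_nonneg (blockSum_lapF_inv_col_nonneg L (cM M₀) hc hm v b')]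
  have htail := exp_tail_le_far hL1 hD ht0 ht (kapA_pos ha 4)
  have hκ2 : 0 < kapA a 4 ^ 2 := pow_pos (kapA_pos ha 4) 2
  calc (L : ℝ) ^ 2 * |((fineOp L (cM M₀) a ((L : ℝ) ^ 2) m2)⁻¹ (u + unitVec (fine L (cM M₀)) ν) v - (fineOp L (cM M₀) a ((L : ℝ) ^ 2) m2)⁻¹ u v)
        - ((lapF (fine L (cM M₀)) ((L : ℝ) ^ 2) m2)⁻¹ (u + unitVec (fine L (cM M₀)) ν) v - (lapF (fine L (cM M₀)) ((L : ℝ) ^ 2) m2)⁻¹ u v)|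
      ≤ (L : ℝ) ^ 2 * (((L : ℝ) ^ 4)⁻¹ * (CDelta a 4 * Real.exp (-(kapA a 4 * (D / 3))) * Φ / m2 + ((L : ℝ) ^ 4 * ((343 * 4940000 / (L : ℝ) ^ 2) / (1 + t) ^ 3)) * CS / m2
          + Φ * CS * ((L : ℝ) ^ 4 * ((49 * C0 / (L : ℝ) ^ 2) / (1 + t ^ 2))))) := mul_le_mul_of_nonneg_left habs hc
    _ = (CDelta a 4 * (92016000 / (m2 * Real.sqrt m2)) / L) * (Real.exp (-(kapA a 4 * (D / 3))) / (L : ℝ) ^ 2)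
        + (343 * 4940000 * CS / m2) / (1 + t) ^ 3 + (92016000 * 49 * C0 * CS / Real.sqrt m2) / ((L : ℝ) * (1 + t ^ 2)) := by
        rw [hΦ]; field_simp
    _ ≤ (CDelta a 4 * (92016000 / (m2 * Real.sqrt m2)) / L) * ((50 / kapA a 4 ^ 2) / (1 + t ^ 2))
        + (343 * 4940000 * CS / m2) / (1 + t) ^ 3 + (92016000 * 49 * C0 * CS / Real.sqrt m2) / ((L : ℝ) * (1 + t ^ 2)) := by
        gcongr
    _ = (343 * 4940000 * CS / m2) / (1 + t) ^ 3
        + (92016000 * (50 * CDelta a 4 / kapA a 4 ^ 2 + 49 * C0 * CS * m2) / (m2 * Real.sqrt m2)) / ((L : ℝ) * (1 + t ^ 2)) := by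
        field_simp; ring

/-- ★★★ **THE NEAR ZONE** (`dist_M(β_u,β_v) < 6`): `L²·|∇_u(A₀⁻¹−G)(u,v)| ≤ (92016000·50·C_Δ∕(m²√m²))∕(L(1+dist²))` (PART ∇-l's uniform `O(η⁵)` bound through Ϻ-b's `1∕L² ≤ 50∕(1+dist²)`).
[cite: King1986, (2.13)–(2.15) p.653, (3.63) p.663, (4.44)–(4.45) p.675] -/
theorem mul_abs_fullProp_grad_correction_le_near (ha : 0 < a) (hm : 0 < m2) (u v : Tor (fine L (cM M₀))) (ν : Fin 4)
    (hD : tdistT (cM M₀) (blockOf L (cM M₀) u) (blockOf L (cM M₀) v) < 6) :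
    (L : ℝ) ^ 2 * |((fineOp L (cM M₀) a ((L : ℝ) ^ 2) m2)⁻¹ (u + unitVec (fine L (cM M₀)) ν) v - (fineOp L (cM M₀) a ((L : ℝ) ^ 2) m2)⁻¹ u v)
        - ((lapF (fine L (cM M₀)) ((L : ℝ) ^ 2) m2)⁻¹ (u + unitVec (fine L (cM M₀)) ν) v - (lapF (fine L (cM M₀)) ((L : ℝ) ^ 2) m2)⁻¹ u v)|
      ≤ (92016000 * (50 * CDelta a 4) / (m2 * Real.sqrt m2)) / ((L : ℝ) * (1 + tdistT (fine L (cM M₀)) u v ^ 2)) := by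
  have hL1 : (1 : ℝ) ≤ L := by exact_mod_cast Nat.one_le_iff_ne_zero.mpr (NeZero.ne L)
  have hL0 : (0 : ℝ) < L := by positivity
  have hsm : 0 < Real.sqrt m2 := Real.sqrt_pos.mpr hm
  have ht0 := tdistT_nonneg (fine L (cM M₀)) u v
  have ht := tdistT_fine_le_blocks L (cM M₀) u v
  have hnear := king_fullProp_grad_correction_le L M₀ ha hm u v ν
  have hconv := inv_sq_le_near hL1 hD ht0 ht
  have hCD := (CDelta_pos ha (3 + 1)).le
  calc (L : ℝ) ^ 2 * |((fineOp L (cM M₀) a ((L : ℝ) ^ 2) m2)⁻¹ (u + unitVec (fine L (cM M₀)) ν) v - (fineOp L (cM M₀) a ((L : ℝ) ^ 2) m2)⁻¹ u v)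
        - ((lapF (fine L (cM M₀)) ((L : ℝ) ^ 2) m2)⁻¹ (u + unitVec (fine L (cM M₀)) ν) v - (lapF (fine L (cM M₀)) ((L : ℝ) ^ 2) m2)⁻¹ u v)|
      ≤ (L : ℝ) ^ 2 * (92016000 * CDelta a (3 + 1) / ((L : ℝ) ^ 5 * m2 * Real.sqrt m2)) := mul_le_mul_of_nonneg_left hnear (by positivity)
    _ = (92016000 * CDelta a 4 / (m2 * Real.sqrt m2) / L) * (1 / (L : ℝ) ^ 2) := by field_simp
    _ ≤ (92016000 * CDelta a 4 / (m2 * Real.sqrt m2) / L) * (50 / (1 + tdistT (fine L (cM M₀)) u v ^ 2)) := mul_le_mul_of_nonneg_left hconv (by positivity)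
    _ = (92016000 * (50 * CDelta a 4) / (m2 * Real.sqrt m2)) / ((L : ℝ) * (1 + tdistT (fine L (cM M₀)) u v ^ 2)) := by field_simp

/-- ★★★★ **THE DECAY OF THE BLOCK CORRECTION's GRADIENT, ALL `u, v`**: for every `L ≥ 1`, `M₀ ≥ 1`, `a, m² > 0`, `ν`:
`L²·|∇_u(A₀⁻¹ − G)(u,v)| ≤ (343·4940000·C_ΔS_κ∕m²)∕(1 + tdistT(u,v))³ + (92016000·(50C_Δ∕κ_A² + 49C₀C_ΔS_κm² + 50C_Δ)∕(m²√m²))∕(L·(1 + tdistT(u,v)²))` — an inverse CUBE plus `η` times an inverse SQUARE;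
with PART ∇-f: `L²|∇_uA₀⁻¹(u,v)| ≤ (4940000 + 343·4940000C_ΔS_κ∕m²)∕(1+dist)³ + η·C′∕(1+dist²)`. [cite: King1986, (2.13)–(2.15) p.653, (3.63) p.663, (4.34) p.674, (4.44)–(4.45) p.675] -/
theorem king_fullProp_grad_correction_decay (ha : 0 < a) (hm : 0 < m2) (u v : Tor (fine L (cM M₀))) (ν : Fin 4) :
    (L : ℝ) ^ 2 * |((fineOp L (cM M₀) a ((L : ℝ) ^ 2) m2)⁻¹ (u + unitVec (fine L (cM M₀)) ν) v - (fineOp L (cM M₀) a ((L : ℝ) ^ 2) m2)⁻¹ u v)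
        - ((lapF (fine L (cM M₀)) ((L : ℝ) ^ 2) m2)⁻¹ (u + unitVec (fine L (cM M₀)) ν) v - (lapF (fine L (cM M₀)) ((L : ℝ) ^ 2) m2)⁻¹ u v)|
      ≤ (343 * 4940000 * (CDelta a 4 * B4Sect5Proof.latticeConst 4 (kapA a 4)) / m2) / (1 + tdistT (fine L (cM M₀)) u v) ^ 3
        + (92016000 * (50 * CDelta a 4 / kapA a 4 ^ 2 + 49 * (34016 + 10 / m2) * (CDelta a 4 * B4Sect5Proof.latticeConst 4 (kapA a 4)) * m2 + 50 * CDelta a 4) / (m2 * Real.sqrt m2))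
            / ((L : ℝ) * (1 + tdistT (fine L (cM M₀)) u v ^ 2)) := by
  have hL0 : (0 : ℝ) < L := by exact_mod_cast Nat.pos_of_ne_zero (NeZero.ne L)
  have hsm : 0 < Real.sqrt m2 := Real.sqrt_pos.mpr hm
  have ht0 := tdistT_nonneg (fine L (cM M₀)) u v
  have hCD := (CDelta_pos ha 4).le
  have hκ2 : 0 < kapA a 4 ^ 2 := pow_pos (kapA_pos ha 4) 2
  have hCS0 : 0 ≤ CDelta a 4 * B4Sect5Proof.latticeConst 4 (kapA a 4) :=
    le_trans (Finset.sum_nonneg fun _ _ => abs_nonneg _) (sum_abs_effLaplacian_le L (cM M₀) ha hm (blockOf L (cM M₀) u))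
  have hB0 : 0 ≤ (343 * 4940000 * (CDelta a 4 * B4Sect5Proof.latticeConst 4 (kapA a 4)) / m2) / (1 + tdistT (fine L (cM M₀)) u v) ^ 3 := by positivity
  have hden : 0 < (L : ℝ) * (1 + tdistT (fine L (cM M₀)) u v ^ 2) := by positivity
  have hfarC : 0 ≤ 92016000 * (50 * CDelta a 4 / kapA a 4 ^ 2 + 49 * (34016 + 10 / m2) * (CDelta a 4 * B4Sect5Proof.latticeConst 4 (kapA a 4)) * m2) / (m2 * Real.sqrt m2) := by positivity
  have hnearC : 0 ≤ 92016000 * (50 * CDelta a 4) / (m2 * Real.sqrt m2) := by positivity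
  have e : 92016000 * (50 * CDelta a 4 / kapA a 4 ^ 2 + 49 * (34016 + 10 / m2) * (CDelta a 4 * B4Sect5Proof.latticeConst 4 (kapA a 4)) * m2 + 50 * CDelta a 4) / (m2 * Real.sqrt m2)
      = 92016000 * (50 * CDelta a 4 / kapA a 4 ^ 2 + 49 * (34016 + 10 / m2) * (CDelta a 4 * B4Sect5Proof.latticeConst 4 (kapA a 4)) * m2) / (m2 * Real.sqrt m2)
        + 92016000 * (50 * CDelta a 4) / (m2 * Real.sqrt m2) := by
    field_simp
  rw [e, add_div]
  rcases le_or_gt 6 (tdistT (cM M₀) (blockOf L (cM M₀) u) (blockOf L (cM M₀) v)) with hD | hD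
  · have h := mul_abs_fullProp_grad_correction_le_far L M₀ ha hm u v ν hD
    have : 0 ≤ 92016000 * (50 * CDelta a 4) / (m2 * Real.sqrt m2) / ((L : ℝ) * (1 + tdistT (fine L (cM M₀)) u v ^ 2)) := div_nonneg hnearC hden.le
    linarith
  · have h := mul_abs_fullProp_grad_correction_le_near L M₀ ha hm u v ν hD
    have : 0 ≤ 92016000 * (50 * CDelta a 4 / kapA a 4 ^ 2 + 49 * (34016 + 10 / m2) * (CDelta a 4 * B4Sect5Proof.latticeConst 4 (kapA a 4)) * m2) / (m2 * Real.sqrt m2)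
        / ((L : ℝ) * (1 + tdistT (fine L (cM M₀)) u v ^ 2)) := div_nonneg hfarC hden.le
    linarith

/-- ★★★ **THE PHYSICAL READING OF THE DECAY**: if `tdistT(u,v) ≥ L·d` with `d > 0` (physical∕block separation `d`), then
`L⁵·|∇_u(A₀⁻¹ − G)(u,v)| ≤ (343·4940000·C_ΔS_κ∕m²)∕d³ + (92016000·(…)∕(m²√m²))∕d²` — the physical gradient of the block correction decays at least like the inverse square of the physical
distance, uniformly in the spacing and the volume. [cite: King1986, (2.13)–(2.15) p.653, (3.63) p.663] -/
theorem king_fullProp_grad_correction_decay_physical (ha : 0 < a) (hm : 0 < m2) (u v : Tor (fine L (cM M₀))) (ν : Fin 4) {dd : ℝ} (hd : 0 < dd)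
    (hsep : (L : ℝ) * dd ≤ tdistT (fine L (cM M₀)) u v) :
    (L : ℝ) ^ 5 * |((fineOp L (cM M₀) a ((L : ℝ) ^ 2) m2)⁻¹ (u + unitVec (fine L (cM M₀)) ν) v - (fineOp L (cM M₀) a ((L : ℝ) ^ 2) m2)⁻¹ u v)
        - ((lapF (fine L (cM M₀)) ((L : ℝ) ^ 2) m2)⁻¹ (u + unitVec (fine L (cM M₀)) ν) v - (lapF (fine L (cM M₀)) ((L : ℝ) ^ 2) m2)⁻¹ u v)|
      ≤ (343 * 4940000 * (CDelta a 4 * B4Sect5Proof.latticeConst 4 (kapA a 4)) / m2) / dd ^ 3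
        + (92016000 * (50 * CDelta a 4 / kapA a 4 ^ 2 + 49 * (34016 + 10 / m2) * (CDelta a 4 * B4Sect5Proof.latticeConst 4 (kapA a 4)) * m2 + 50 * CDelta a 4) / (m2 * Real.sqrt m2)) / dd ^ 2 := by
  have hL0 : (0 : ℝ) < L := by exact_mod_cast Nat.pos_of_ne_zero (NeZero.ne L)
  have hsm : 0 < Real.sqrt m2 := Real.sqrt_pos.mpr hm
  have hCD := (CDelta_pos ha 4).le
  have hκ2 : 0 < kapA a 4 ^ 2 := pow_pos (kapA_pos ha 4) 2
  have hCS0 : 0 ≤ CDelta a 4 * B4Sect5Proof.latticeConst 4 (kapA a 4) :=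
    le_trans (Finset.sum_nonneg fun _ _ => abs_nonneg _) (sum_abs_effLaplacian_le L (cM M₀) ha hm (blockOf L (cM M₀) u))
  set CB := 343 * 4940000 * (CDelta a 4 * B4Sect5Proof.latticeConst 4 (kapA a 4)) / m2 with hCB
  set C' := 92016000 * (50 * CDelta a 4 / kapA a 4 ^ 2 + 49 * (34016 + 10 / m2) * (CDelta a 4 * B4Sect5Proof.latticeConst 4 (kapA a 4)) * m2 + 50 * CDelta a 4) / (m2 * Real.sqrt m2) with hC'
  have hCB0 : 0 ≤ CB := by positivity
  have hC'0 : 0 ≤ C' := by positivity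
  set t := tdistT (fine L (cM M₀)) u v with ht
  have hLd : 0 < (L : ℝ) * dd := by positivity
  have h := king_fullProp_grad_correction_decay L M₀ ha hm u v ν
  have ht0' : 0 ≤ t := tdistT_nonneg (fine L (cM M₀)) u v
  have h1t : 0 < (1 + t) ^ 3 := by positivity
  have h1t2 : 0 < (L : ℝ) * (1 + t ^ 2) := by positivity
  have h3 : (L : ℝ) ^ 3 * (CB / (1 + t) ^ 3) ≤ CB / dd ^ 3 := by
    rw [mul_div_assoc', div_le_div_iff₀ h1t (by positivity)]
    have : ((L : ℝ) * dd) ^ 3 ≤ (1 + t) ^ 3 := pow_le_pow_left₀ hLd.le (by linarith) 3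
    nlinarith [this, pow_pos hL0 3]
  have h2 : (L : ℝ) ^ 3 * (C' / ((L : ℝ) * (1 + t ^ 2))) ≤ C' / dd ^ 2 := by
    rw [mul_div_assoc', div_le_div_iff₀ h1t2 (by positivity)]
    have : ((L : ℝ) * dd) ^ 2 ≤ 1 + t ^ 2 := by nlinarith [pow_le_pow_left₀ hLd.le hsep 2]
    nlinarith [this, pow_pos hL0 3, mul_nonneg hC'0 (pow_nonneg hL0.le 2)]
  calc (L : ℝ) ^ 5 * |((fineOp L (cM M₀) a ((L : ℝ) ^ 2) m2)⁻¹ (u + unitVec (fine L (cM M₀)) ν) v - (fineOp L (cM M₀) a ((L : ℝ) ^ 2) m2)⁻¹ u v)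
        - ((lapF (fine L (cM M₀)) ((L : ℝ) ^ 2) m2)⁻¹ (u + unitVec (fine L (cM M₀)) ν) v - (lapF (fine L (cM M₀)) ((L : ℝ) ^ 2) m2)⁻¹ u v)|
      = (L : ℝ) ^ 3 * ((L : ℝ) ^ 2 * |((fineOp L (cM M₀) a ((L : ℝ) ^ 2) m2)⁻¹ (u + unitVec (fine L (cM M₀)) ν) v - (fineOp L (cM M₀) a ((L : ℝ) ^ 2) m2)⁻¹ u v)
        - ((lapF (fine L (cM M₀)) ((L : ℝ) ^ 2) m2)⁻¹ (u + unitVec (fine L (cM M₀)) ν) v - (lapF (fine L (cM M₀)) ((L : ℝ) ^ 2) m2)⁻¹ u v)|) := by ring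
    _ ≤ (L : ℝ) ^ 3 * (CB / (1 + t) ^ 3 + C' / ((L : ℝ) * (1 + t ^ 2))) := mul_le_mul_of_nonneg_left h (by positivity)
    _ = (L : ℝ) ^ 3 * (CB / (1 + t) ^ 3) + (L : ℝ) ^ 3 * (C' / ((L : ℝ) * (1 + t ^ 2))) := by ring
    _ ≤ CB / dd ^ 3 + C' / dd ^ 2 := add_le_add h3 h2

end Summit.QuantumFields.YangMills.BalabanUVNodes.N15KingModelRung.HeatKernel

end
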